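import Summits.QuantumFields.YangMills.Theorems.UnitScaleTiltProp7CovariantWeitzenbock
import Summits.QuantumFields.YangMills.Theorems.UnitScaleTiltProp7PinnedHodgeSplit
import Literature.MathematicalPhysics.QuantumFieldTheory.Balaban1983to89.T3ContinuumYM3Torus
import HarnessLib

/-!
# Route `UnitScaleTilt`, crux K1 «MinimiserStabilityRegPr» (stmt-QuantumFields-19200), line «route-R» (S2) — N1–N3 CURVED:
# THE COVARIANT HODGE SPLIT OF A MATRIX BOND FIELD AT AN EXACT UNITARY BACKGROUND, `Y = B + D_Uφ`, `D^*_U B = 0`, THE HILBERT–SCHMIDT PYTHAGORAS,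
# AND THE DIRICHLET PRINCIPLE FOR THE PINNED SLICE (OWNER g26 ASSIGNMENTS 18 (b): bricks (i)–(iv), background-generic)

Cell `ym3-torus`, D-0154 (3c) twin-width seat `ym-routeR-w1` (gen 0); `--supports stmt-QuantumFields-19200 --as helper`; THEOREMS ONLY (0 `def`, 0 `sorry`).
YM₃ on T³ is a ladder rung (R3), not the Clay problem; nothing here claims the stub, the crux, d = 4 or the mass gap.

WHY.  The flat P-lin chain N1–N7 (✓ p596259 … p600443) and its robust forms F1–F6 start from the Hodge split of ★p1 g11's CARD §2; its curved upgrade (CARD §6 (S2),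
first item) replaces `∂`, `∂^*` by p483802's covariant `D_U`, `D^*_U` (`B9Eq39Adjoint.covD ∕ covDstar ∕ divB`, transport `R(u)X = uXu⁻¹`).  At a UNITARY background the
transport commutes with `ᴴ` (✓ `Prop7CovariantCoercivity.conjTranspose_R`), so (3.8)'s trace adjointness `Σ τ((D_μf)·G) = Σ τ(f·(D^*_μG))` (`B9Eq39Adjoint.sum_sum_covD_mul`) becomes
the HILBERT–SCHMIDT adjointness `⟪D_Uf, G⟫ = ⟪f, D^*_UG⟫`, `⟪A, B⟫ = Σ tr(AᴴB)`; the Hodge split is then the orthogonal projection onto `range D_U` in the Euclidean space of entry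
coordinates (`EuclideanSpace ℂ ((Fin d × Site) × (Fin N × Fin N))`, the pattern of ✓ p596259 `exists_coulombGauge`), and the pinned Dirichlet principle is the flat argument verbatim.
The ONE honest difference from the flat case — `curl_U ∘ D_U ≠ 0` — is the curvature commutator of ✓ p601297 `Prop7CovariantCurlOfGrad.norm_curl_covD_le` (not re-proved here).

WHAT IS PROVED (sorry-free, no definition; torus carrier `Site P i`, shifts `torusT P i`, `U : Fin P.d → Site P i → (M_N(ℂ))ˣ` with UNITARY values; then the T³ instance):
* §1 brick (i) — `ᴴ` commutes with the covariant operators — is ALREADY IN THE TREE (★p1 g2's `Prop7CovariantCoercivity.conjTranspose_covD ∕ _covDstar ∕ _divB ∕ _curl`,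
  file `…CovariantWeitzenbock`) and is imported, not restated; this § only adds `covD_zero`, `divB_sub`.
* §2 `trace_conjTranspose_mul_eq_sum` (`tr(MᴴB) = Σ conj(M_{ab})B_{ab}`), ★ `sum_trace_conjTranspose_covD_mul` — HS adjointness `Σ_{x,μ} tr((D_μf)(x)ᴴA_μ(x)) = Σ_x tr(f(x)ᴴ(D^*A)(x))` (brick (ii)).
* §3 ★★ `exists_covHodgeSplit` — `∃ φ`, (a) `D^*_U(A − D_Uφ) = 0`, (b) `Σ|A|²_HS = Σ|A − D_Uφ|²_HS + Σ|D_Uφ|²_HS` (brick (iii)).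
* §4 `sum_normSq_add_eq` (the HS binomial), ★★ `sum_normSq_covD_le_of_eq_on_support` — PINNED DIRICHLET PRINCIPLE: if `D^*_UA` is supported on `C` and `φ` is a Hodge potential
  of `A`, every `ψ` with `ψ = φ` on `C` has `Σ|D_Uφ|²_HS ≤ Σ|D_Uψ|²_HS` (brick (iv)).
* §5 ★ `exists_covHodgeSplit_T3` — the reading on run `K` of a T³ family at an `SU(2)` background `U₀` (`unitsField (toUField U₀)`), bond sums as `Σ_b`.

HONEST SCOPE.  Finite-dimensional linear algebra at an exact unitary background; no smallness, no estimate of Bałaban's is asserted; the flat special case `U ≡ 1` is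
✓ p598972 `Prop7MatrixHodgeSplit` (not re-derived).

References: T. Bałaban, CMP 99 (1985) 389–434 [Balaban1985BackgroundPropagators] ((3.3)–(3.4) pp.390–391, (3.8) p.392); CMP 95 (1984) 17–40 [Balaban1984PropagatorsI]
((1.21) p.21); CMP 102 (1985) 277–309 [Balaban1985Variational] (Prop. 7 p.299, (141)–(143)).
-/

set_option autoImplicit false

noncomputable section

open scoped BigOperators Matrix.Norms.L2Operator Matrix InnerProductSpace

namespace Summit.QuantumFields.YangMills.Theorems.Prop7CovHodgeSplit

open Literature.MathematicalPhysics.QuantumFieldTheory.Balaban1983to89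
open B9Eq39Adjoint (R R_def covD covDstar divB curl covD_add covD_sub covD_smul covDstar_sub sum_sum_covD_mul)
open Summit.QuantumFields.YangMills.Theorems.Prop7CovariantCoercivity (conjTranspose_R coe_inv_eq_star re_trace_conjTranspose_mul_self inv_mem_unitary
  conjTranspose_covD conjTranspose_covDstar conjTranspose_divB conjTranspose_curl)
open B9TorusCalculus (torusT)

/-! ## §1 The torus carrier; `D_{U,μ}0 = 0`, `D^*_U` is subtractive (brick (i) is imported from `Prop7CovariantCoercivity`) -/

section Torus

variable {P : Params} {i : ℕ} {N : ℕ} (U : Fin P.d → Site P i → (Matrix (Fin N) (Fin N) ℂ)ˣ)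

/-- `D_{U,μ} 0 = 0`. [folklore] -/
theorem covD_zero (μ : Fin P.d) (x : Site P i) : covD (torusT P i) U μ (fun _ : Site P i => (0 : Matrix (Fin N) (Fin N) ℂ)) x = 0 := by
  simp [covD, R_def]

/-- `D^*_U` is subtractive. [folklore] -/
theorem divB_sub (A B : Fin P.d → Site P i → Matrix (Fin N) (Fin N) ℂ) (x : Site P i) :
    divB (torusT P i) U (fun μ y => A μ y - B μ y) x = divB (torusT P i) U A x - divB (torusT P i) U B x := by
  simp only [divB, ← Finset.sum_sub_distrib]
  exact Finset.sum_congr rfl fun μ _ => covDstar_sub (torusT P i) U μ (A μ) (B μ) x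

/-! ## §2 Hilbert–Schmidt adjointness of `D_U` and `D^*_U` -/

/-- `tr(MᴴB) = Σ_{a,b} conj(M_{ab})·B_{ab}`. [folklore] -/
theorem trace_conjTranspose_mul_eq_sum (M B : Matrix (Fin N) (Fin N) ℂ) :
    (Mᴴ * B).trace = ∑ a : Fin N, ∑ b : Fin N, (starRingEnd ℂ) (M a b) * B a b := by
  rw [Matrix.trace, Finset.sum_comm]
  refine Finset.sum_congr rfl fun b _ => ?_
  rw [Matrix.diag_apply, Matrix.mul_apply]
  refine Finset.sum_congr rfl fun a _ => ?_
  rw [Matrix.conjTranspose_apply, Complex.star_def]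

/-- ★ **HILBERT–SCHMIDT ADJOINTNESS** at a unitary background: `Σ_x Σ_μ tr((D_{U,μ}f)(x)ᴴ·A_μ(x)) = Σ_x tr(f(x)ᴴ·(D^*_UA)(x))` ((3.8) for the trace pairing, with
`(D_μf)ᴴ = D_μ(fᴴ)`). [cite: Balaban1985BackgroundPropagators, (3.8) p.392] -/
theorem sum_trace_conjTranspose_covD_mul
    (hU : ∀ (μ : Fin P.d) (x : Site P i), (U μ x : Matrix (Fin N) (Fin N) ℂ) ∈ unitary (Matrix (Fin N) (Fin N) ℂ))
    (f : Site P i → Matrix (Fin N) (Fin N) ℂ) (A : Fin P.d → Site P i → Matrix (Fin N) (Fin N) ℂ) :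
    ∑ x : Site P i, ∑ μ : Fin P.d, ((covD (torusT P i) U μ f x)ᴴ * A μ x).trace = ∑ x : Site P i, ((f x)ᴴ * divB (torusT P i) U A x).trace := by
  simp only [conjTranspose_covD hU]
  have h := sum_sum_covD_mul (torusT P i) U (Matrix.traceAddMonoidHom (Fin N) ℂ) (fun a b => Matrix.trace_mul_comm a b) (fun y => (f y)ᴴ) A
  simpa only [Matrix.traceAddMonoidHom_apply] using h

/-! ## §3 The covariant Hodge split: orthogonal projection onto `range D_U` in the Hilbert–Schmidt geometry -/

/-- ★★ **THE COVARIANT HODGE SPLIT** (unitary background, finite carrier): every `M_N(ℂ)`-valued bond field `A` has a covariant potential `φ` with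
(a) `D^*_U(A − D_Uφ) = 0` and (b) `Σ_{μ,x}|A_μ(x)|²_HS = Σ_{μ,x}|(A − D_Uφ)_μ(x)|²_HS + Σ_{μ,x}|(D_Uφ)_μ(x)|²_HS` — the orthogonal projection of `A` onto `range D_U`.
[cite: Balaban1984PropagatorsI, (1.21) p.21; Balaban1985BackgroundPropagators, (3.8) p.392] -/
theorem exists_covHodgeSplit
    (hU : ∀ (μ : Fin P.d) (x : Site P i), (U μ x : Matrix (Fin N) (Fin N) ℂ) ∈ unitary (Matrix (Fin N) (Fin N) ℂ))
    (A : Fin P.d → Site P i → Matrix (Fin N) (Fin N) ℂ) :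
    ∃ φ : Site P i → Matrix (Fin N) (Fin N) ℂ,
      (∀ x : Site P i, divB (torusT P i) U (fun μ y => A μ y - covD (torusT P i) U μ φ y) x = 0) ∧
      ∑ μ : Fin P.d, ∑ x : Site P i, ∑ a : Fin N, ∑ b : Fin N, Complex.normSq (A μ x a b)
        = ∑ μ : Fin P.d, ∑ x : Site P i, ∑ a : Fin N, ∑ b : Fin N, Complex.normSq ((A μ x - covD (torusT P i) U μ φ x) a b)
          + ∑ μ : Fin P.d, ∑ x : Site P i, ∑ a : Fin N, ∑ b : Fin N, Complex.normSq ((covD (torusT P i) U μ φ x) a b) := by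
  classical
  -- entry coordinates of bond fields
  let J := (Fin P.d × Site P i) × (Fin N × Fin N)
  let crd : (Fin P.d → Site P i → Matrix (Fin N) (Fin N) ℂ) → J → ℂ := fun B j => B j.1.1 j.1.2 j.2.1 j.2.2
  -- the range of the covariant gradient, as a subspace of the Euclidean space of coordinates
  let K : Submodule ℂ (EuclideanSpace ℂ J) :=
    { carrier := {v | ∃ φ : Site P i → Matrix (Fin N) (Fin N) ℂ, WithLp.ofLp v = crd (fun μ y => covD (torusT P i) U μ φ y)}
      add_mem' := by
        rintro v w ⟨φ, hv⟩ ⟨φ', hw⟩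
        refine ⟨fun y => φ y + φ' y, ?_⟩
        rw [WithLp.ofLp_add, hv, hw]
        funext j
        show covD (torusT P i) U j.1.1 φ j.1.2 j.2.1 j.2.2 + covD (torusT P i) U j.1.1 φ' j.1.2 j.2.1 j.2.2 = covD (torusT P i) U j.1.1 (fun y => φ y + φ' y) j.1.2 j.2.1 j.2.2
        rw [← Matrix.add_apply, ← covD_add]
        rfl
      zero_mem' := by
        refine ⟨fun _ => 0, ?_⟩
        rw [WithLp.ofLp_zero]
        funext j
        show (0 : ℂ) = covD (torusT P i) U j.1.1 (fun _ => 0) j.1.2 j.2.1 j.2.2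
        rw [covD_zero]
        rfl
      smul_mem' := by
        rintro c v ⟨φ, hv⟩
        refine ⟨fun y => c • φ y, ?_⟩
        rw [WithLp.ofLp_smul, hv]
        funext j
        show c * covD (torusT P i) U j.1.1 φ j.1.2 j.2.1 j.2.2 = covD (torusT P i) U j.1.1 (fun y => c • φ y) j.1.2 j.2.1 j.2.2
        rw [show (fun y => c • φ y) = c • φ from rfl, covD_smul, Matrix.smul_apply, smul_eq_mul] }
  let u : EuclideanSpace ℂ J := WithLp.toLp 2 (crd A)
  obtain ⟨φ, hφ⟩ : K.starProjection u ∈ K := K.starProjection_apply_mem u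
  have horth : u - K.starProjection u ∈ Kᗮ := K.sub_starProjection_mem_orthogonal u
  -- coordinates of the remainder
  have hrem : ∀ j : J, (u - K.starProjection u) j = crd (fun μ y => A μ y - covD (torusT P i) U μ φ y) j := by
    intro j
    show (WithLp.ofLp (u - K.starProjection u)) j = _
    rw [WithLp.ofLp_sub, Pi.sub_apply, hφ]
    rfl
  -- the Hilbert–Schmidt pairing in coordinates
  have hinner : ∀ (B B' : Fin P.d → Site P i → Matrix (Fin N) (Fin N) ℂ),
      ∑ j : J, (starRingEnd ℂ) (crd B j) * crd B' j = ∑ x : Site P i, ∑ μ : Fin P.d, ((B μ x)ᴴ * B' μ x).trace := by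
    intro B B'
    rw [Fintype.sum_prod_type, Fintype.sum_prod_type, Finset.sum_comm]
    refine Finset.sum_congr rfl fun x _ => Finset.sum_congr rfl fun μ _ => ?_
    rw [trace_conjTranspose_mul_eq_sum, Fintype.sum_prod_type]
  refine ⟨φ, ?_, ?_⟩
  · -- (a) test the orthogonality against `D_U ψ`, `ψ := D^*_U(A − D_Uφ)`
    set B : Fin P.d → Site P i → Matrix (Fin N) (Fin N) ℂ := fun μ y => A μ y - covD (torusT P i) U μ φ y with hB
    set ψ : Site P i → Matrix (Fin N) (Fin N) ℂ := fun y => divB (torusT P i) U B y with hψ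
    have hw : (WithLp.toLp 2 (crd (fun μ y => covD (torusT P i) U μ ψ y)) : EuclideanSpace ℂ J) ∈ K := ⟨ψ, rfl⟩
    have h0 := Submodule.inner_right_of_mem_orthogonal hw horth
    have h1 : ⟪(WithLp.toLp 2 (crd (fun μ y => covD (torusT P i) U μ ψ y)) : EuclideanSpace ℂ J), u - K.starProjection u⟫_ℂ
        = ∑ j : J, (starRingEnd ℂ) (crd (fun μ y => covD (torusT P i) U μ ψ y) j) * crd B j := by
      simp only [PiLp.inner_apply, RCLike.inner_apply]
      refine Finset.sum_congr rfl fun j _ => ?_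
      rw [hrem j, mul_comm]
    rw [h1] at h0
    have h2 : ∑ x : Site P i, ∑ μ : Fin P.d, ((covD (torusT P i) U μ ψ x)ᴴ * B μ x).trace = 0 := by
      rw [← hinner]; exact h0
    rw [sum_trace_conjTranspose_covD_mul U hU] at h2
    -- `h2 : Σ_x tr(ψ(x)ᴴ·(D^*B)(x)) = 0` with `ψ = D^*B`
    have hre : ∑ x : Site P i, ∑ a : Fin N, ∑ b : Fin N, ‖(divB (torusT P i) U B x) a b‖ ^ 2 = 0 := by
      have := congrArg Complex.re h2
      rw [Complex.re_sum, Complex.zero_re] at this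
      simpa only [hψ, re_trace_conjTranspose_mul_self] using this
    intro x
    have hx := (Finset.sum_eq_zero_iff_of_nonneg fun x _ => Finset.sum_nonneg fun a _ => Finset.sum_nonneg fun b _ => sq_nonneg _).mp hre x
      (Finset.mem_univ x)
    ext a b
    have ha := (Finset.sum_eq_zero_iff_of_nonneg fun a _ => Finset.sum_nonneg fun b _ => sq_nonneg _).mp hx a (Finset.mem_univ a)
    have hab := (Finset.sum_eq_zero_iff_of_nonneg fun b _ => sq_nonneg _).mp ha b (Finset.mem_univ b)
    have := pow_eq_zero_iff (n := 2) (by norm_num) |>.mp hab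
    simpa using this
  · -- (b) Pythagoras
    have hP : ⟪u - K.starProjection u, K.starProjection u⟫_ℂ = 0 :=
      Submodule.inner_left_of_mem_orthogonal (K.starProjection_apply_mem u) horth
    have hpy := norm_add_sq_eq_norm_sq_add_norm_sq_of_inner_eq_zero _ _ hP
    rw [sub_add_cancel] at hpy
    -- squared norms in coordinates
    have hnorm : ∀ (v : EuclideanSpace ℂ J) (B : Fin P.d → Site P i → Matrix (Fin N) (Fin N) ℂ), (∀ j, v j = crd B j) →
        ‖v‖ * ‖v‖ = ∑ μ : Fin P.d, ∑ x : Site P i, ∑ a : Fin N, ∑ b : Fin N, Complex.normSq (B μ x a b) := by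
      intro v B hv
      rw [← sq, EuclideanSpace.norm_sq_eq, Fintype.sum_prod_type, Fintype.sum_prod_type]
      refine Finset.sum_congr rfl fun μ _ => Finset.sum_congr rfl fun x _ => ?_
      rw [Fintype.sum_prod_type]
      refine Finset.sum_congr rfl fun a _ => Finset.sum_congr rfl fun b _ => ?_
      rw [hv, Complex.sq_norm]
    rw [hnorm u A (fun j => rfl), hnorm (u - K.starProjection u) (fun μ y => A μ y - covD (torusT P i) U μ φ y) hrem,
      hnorm (K.starProjection u) (fun μ y => covD (torusT P i) U μ φ y) (fun j => congrFun hφ j)] at hpy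
    exact hpy

/-! ## §4 The pinned Dirichlet principle for the covariant potential -/

/-- **THE HILBERT–SCHMIDT BINOMIAL**: `Σ|P + Q|²_HS = Σ|P|²_HS + Σ|Q|²_HS + 2·Re tr(QᴴP)`. [folklore] -/
theorem sum_normSq_add_eq (P Q : Matrix (Fin N) (Fin N) ℂ) :
    ∑ a : Fin N, ∑ b : Fin N, Complex.normSq ((P + Q) a b)
      = ∑ a : Fin N, ∑ b : Fin N, Complex.normSq (P a b) + ∑ a : Fin N, ∑ b : Fin N, Complex.normSq (Q a b) + 2 * ((Qᴴ * P).trace).re := by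
  rw [trace_conjTranspose_mul_eq_sum, Complex.re_sum, Finset.mul_sum, ← Finset.sum_add_distrib, ← Finset.sum_add_distrib]
  refine Finset.sum_congr rfl fun a _ => ?_
  rw [Complex.re_sum, Finset.mul_sum, ← Finset.sum_add_distrib, ← Finset.sum_add_distrib]
  refine Finset.sum_congr rfl fun b _ => ?_
  simp only [Matrix.add_apply, Complex.normSq_apply, Complex.add_re, Complex.add_im, Complex.mul_re, Complex.conj_re, Complex.conj_im]
  ring

/-- ★★ **THE PINNED DIRICHLET PRINCIPLE, COVARIANT**: if `D^*_UA` is supported on `C` and `φ` is a covariant Hodge potential of `A` (`D^*_U(A − D_Uφ) = 0`), then every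
`ψ` agreeing with `φ` on `C` has `Σ|D_Uφ|²_HS ≤ Σ|D_Uψ|²_HS` — with `η = ψ − φ`, `Σ|D_Uψ|² = Σ|D_Uφ|² + Σ|D_Uη|² + 2Re Σ tr((D_Uη)ᴴD_Uφ)` and the cross term is
`Σ_x tr(η(x)ᴴ·(D^*_UA)(x)) = 0` sitewise (`η = 0` on `C`, `D^*_UA = 0` off `C`). [cite: Balaban1985Variational, Prop. 7 p.299, (141)-(143) p.299] -/
theorem sum_normSq_covD_le_of_eq_on_support
    (hU : ∀ (μ : Fin P.d) (x : Site P i), (U μ x : Matrix (Fin N) (Fin N) ℂ) ∈ unitary (Matrix (Fin N) (Fin N) ℂ))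
    {A : Fin P.d → Site P i → Matrix (Fin N) (Fin N) ℂ} {φ : Site P i → Matrix (Fin N) (Fin N) ℂ}
    (hφ : ∀ x : Site P i, divB (torusT P i) U (fun μ y => A μ y - covD (torusT P i) U μ φ y) x = 0)
    {C : Set (Site P i)} (hA : ∀ x : Site P i, x ∉ C → divB (torusT P i) U A x = 0)
    (ψ : Site P i → Matrix (Fin N) (Fin N) ℂ) (hψ : ∀ x ∈ C, ψ x = φ x) :
    ∑ μ : Fin P.d, ∑ x : Site P i, ∑ a : Fin N, ∑ b : Fin N, Complex.normSq ((covD (torusT P i) U μ φ x) a b)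
      ≤ ∑ μ : Fin P.d, ∑ x : Site P i, ∑ a : Fin N, ∑ b : Fin N, Complex.normSq ((covD (torusT P i) U μ ψ x) a b) := by
  classical
  set η : Site P i → Matrix (Fin N) (Fin N) ℂ := fun y => ψ y - φ y with hη
  have hsplit : ∀ (μ : Fin P.d) (x : Site P i), covD (torusT P i) U μ ψ x = covD (torusT P i) U μ φ x + covD (torusT P i) U μ η x := by
    intro μ x
    have : ψ = φ + η := by funext y; simp [hη]
    rw [this, covD_add]
  -- the cross term vanishes: `Σ_{μ,x} tr((D_μη)ᴴ D_μφ) = Σ_x tr(ηᴴ · D^*(Dφ)) = Σ_x tr(ηᴴ · D^*A) = 0`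
  have hdivφ : ∀ x : Site P i, divB (torusT P i) U (fun μ y => covD (torusT P i) U μ φ y) x = divB (torusT P i) U A x := by
    intro x
    have h := hφ x
    rw [divB_sub] at h
    exact (sub_eq_zero.mp h).symm
  have hcross : ∑ x : Site P i, ∑ μ : Fin P.d, ((covD (torusT P i) U μ η x)ᴴ * covD (torusT P i) U μ φ x).trace = 0 := by
    rw [sum_trace_conjTranspose_covD_mul U hU η (fun μ y => covD (torusT P i) U μ φ y)]
    refine Finset.sum_eq_zero fun x _ => ?_
    rw [hdivφ x]
    by_cases hx : x ∈ C
    · have : η x = 0 := by rw [hη]; exact sub_eq_zero.mpr (hψ x hx)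
      rw [this, Matrix.conjTranspose_zero, Matrix.zero_mul, Matrix.trace_zero]
    · rw [hA x hx, Matrix.mul_zero, Matrix.trace_zero]
  have hcrossRe : ∑ μ : Fin P.d, ∑ x : Site P i, ((covD (torusT P i) U μ η x)ᴴ * covD (torusT P i) U μ φ x).trace.re = 0 := by
    rw [Finset.sum_comm]
    have := congrArg Complex.re hcross
    rw [Complex.re_sum, Complex.zero_re] at this
    simpa only [Complex.re_sum] using this
  -- expand and drop the nonnegative `Σ|D_Uη|²`
  have hexp : ∑ μ : Fin P.d, ∑ x : Site P i, ∑ a : Fin N, ∑ b : Fin N, Complex.normSq ((covD (torusT P i) U μ ψ x) a b)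
      = ∑ μ : Fin P.d, ∑ x : Site P i, ∑ a : Fin N, ∑ b : Fin N, Complex.normSq ((covD (torusT P i) U μ φ x) a b)
        + ∑ μ : Fin P.d, ∑ x : Site P i, ∑ a : Fin N, ∑ b : Fin N, Complex.normSq ((covD (torusT P i) U μ η x) a b)
        + 2 * ∑ μ : Fin P.d, ∑ x : Site P i, ((covD (torusT P i) U μ η x)ᴴ * covD (torusT P i) U μ φ x).trace.re := by
    rw [Finset.mul_sum, ← Finset.sum_add_distrib, ← Finset.sum_add_distrib]
    refine Finset.sum_congr rfl fun μ _ => ?_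
    rw [Finset.mul_sum, ← Finset.sum_add_distrib, ← Finset.sum_add_distrib]
    refine Finset.sum_congr rfl fun x _ => ?_
    rw [hsplit μ x, sum_normSq_add_eq]
  rw [hexp, hcrossRe, mul_zero, add_zero]
  have : 0 ≤ ∑ μ : Fin P.d, ∑ x : Site P i, ∑ a : Fin N, ∑ b : Fin N, Complex.normSq ((covD (torusT P i) U μ η x) a b) :=
    Finset.sum_nonneg fun _ _ => Finset.sum_nonneg fun _ _ => Finset.sum_nonneg fun _ _ => Finset.sum_nonneg fun _ _ => Complex.normSq_nonneg _
  linarith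

end Torus

/-! ## §5 The reading on the T³ carrier at an `SU(2)` background -/

section T3

open Literature.MathematicalPhysics.QuantumFieldTheory.Balaban1983to89.T3ContinuumYM3Torus
open B10Eq27TorusAxialLog (unitsField toUField unitsField_mem_unitaryUnits)
open B10StarCount (sum_pbond)

/-- the `SU(2)` background read through `unitsField ∘ toUField` has unitary values. [cite: Balaban1985Averaging, (9) p.19] -/
theorem unitsField_toUField_mem_unitary {P : Params} {j : ℕ} (U₀ : GaugeField P j (Matrix.specialUnitaryGroup (Fin 2) ℂ)) (κ : Fin P.d) (z : Site P j) :
    ((unitsField (toUField U₀) ⟨z, κ⟩ : (Matrix (Fin 2) (Fin 2) ℂ)ˣ) : Matrix (Fin 2) (Fin 2) ℂ) ∈ unitary (Matrix (Fin 2) (Fin 2) ℂ) :=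
  B7Prop2Explicit.mem_unitaryUnits.mp (unitsField_mem_unitaryUnits (toUField U₀) ⟨z, κ⟩)

/-- bond sums: `Σ_κ Σ_z f ⟨z, κ⟩ = Σ_b f b`. [folklore] -/
theorem sum_dir_site_eq_sum_pbond {P : Params} {j : ℕ} {M : Type*} [AddCommMonoid M] (f : PBond P j → M) :
    ∑ κ : Fin P.d, ∑ z : Site P j, f ⟨z, κ⟩ = ∑ b : PBond P j, f b := by
  rw [sum_pbond, Finset.sum_comm]

/-- ★ **THE COVARIANT HODGE SPLIT ON THE T³ CARRIER** (run `K` of a T³ family, `SU(2)` background `U₀`, p483802's letters): every `M₂(ℂ)`-valued bond field `Y` on the finest torus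
has a covariant potential `φ` with `D^*_{U₀}(Y − D_{U₀}φ) = 0` and `Σ_b|Y(b)|²_HS = Σ_b|(Y − D_{U₀}φ)(b)|²_HS + Σ_b|(D_{U₀}φ)(b)|²_HS`.
[cite: Balaban1984PropagatorsI, (1.21) p.21; Balaban1985BackgroundPropagators, (3.8) p.392] -/
theorem exists_covHodgeSplit_T3 (F : T3Family) (K : ℕ) (U₀ : GaugeField (F.P K) 0 (Matrix.specialUnitaryGroup (Fin 2) ℂ))
    (Y : PBond (F.P K) 0 → Matrix (Fin 2) (Fin 2) ℂ) :
    ∃ φ : Site (F.P K) 0 → Matrix (Fin 2) (Fin 2) ℂ,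
      (∀ x : Site (F.P K) 0, divB (torusT (F.P K) 0) (fun κ z => unitsField (toUField U₀) ⟨z, κ⟩)
          (fun κ z => Y ⟨z, κ⟩ - covD (torusT (F.P K) 0) (fun κ z => unitsField (toUField U₀) ⟨z, κ⟩) κ φ z) x = 0) ∧
      ∑ b : PBond (F.P K) 0, ∑ a : Fin 2, ∑ b' : Fin 2, Complex.normSq ((Y b) a b')
        = ∑ b : PBond (F.P K) 0, ∑ a : Fin 2, ∑ b' : Fin 2,
            Complex.normSq ((Y b - covD (torusT (F.P K) 0) (fun κ z => unitsField (toUField U₀) ⟨z, κ⟩) b.dir φ b.src) a b')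
          + ∑ b : PBond (F.P K) 0, ∑ a : Fin 2, ∑ b' : Fin 2,
            Complex.normSq ((covD (torusT (F.P K) 0) (fun κ z => unitsField (toUField U₀) ⟨z, κ⟩) b.dir φ b.src) a b') := by
  obtain ⟨φ, hdiv, hE⟩ := exists_covHodgeSplit (fun κ z => unitsField (toUField U₀) ⟨z, κ⟩) (unitsField_toUField_mem_unitary U₀) (fun κ z => Y ⟨z, κ⟩)
  refine ⟨φ, hdiv, ?_⟩
  rw [sum_dir_site_eq_sum_pbond (fun b : PBond (F.P K) 0 => ∑ a : Fin 2, ∑ b' : Fin 2, Complex.normSq ((Y b) a b')),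
    sum_dir_site_eq_sum_pbond (fun b : PBond (F.P K) 0 => ∑ a : Fin 2, ∑ b' : Fin 2,
      Complex.normSq ((Y b - covD (torusT (F.P K) 0) (fun κ z => unitsField (toUField U₀) ⟨z, κ⟩) b.dir φ b.src) a b')),
    sum_dir_site_eq_sum_pbond (fun b : PBond (F.P K) 0 => ∑ a : Fin 2, ∑ b' : Fin 2,
      Complex.normSq ((covD (torusT (F.P K) 0) (fun κ z => unitsField (toUField U₀) ⟨z, κ⟩) b.dir φ b.src) a b'))] at hE
  exact hE

end T3

end Summit.QuantumFields.YangMills.Theorems.Prop7CovHodgeSplit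

end
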